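import Mathlib
import Summits.NavierStokesRegularity.NavierStokesRegularity.Theorems.EulerZoomLiouvillePowerGaugeEulerLiouvilleSmallMomentTools
import HarnessLib

/-!
# Crux `EulerZoomLiouville.PowerGaugeEulerLiouville` (stmt-NavierStokesRegularity-19832): t60-ΠLOG piece S3 — LOCALISATION OF THE PROFILE AT SCALE `R`

Width/portrait piece (`--supports stmt-NavierStokesRegularity-19832 --as helper`; LEAD 19832 ns-typeII-p2 g16 KEY S58c-3, 12:31:27Z) of nsreg-p2's
instrument t60-ΠLOG («pressure budget with a logarithm, modulo constants, scale by scale»; `r58/Sketch58b.lean` 16d8b95ef8e183bb, sub-cut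
`r58/Sketch58c.lean` c6fe466b7b48535d, namespace `NsregP2.R58c`).  This file proves piece **S3 `Localise ρ`** with the texts `EBudget` /
`VelocityBudget` δ-UNFOLDED (the file stays definition-free): for a `C²` field `V` with the E-budget `∫ ‖DV‖² ‖y‖^{ρ−1} < ∞` and the velocity budget
`∫_{B_R} ‖V‖² ≤ A R^{1−2ρ}` (`R ≥ 1`), `−2 ≤ ρ ≤ 1`, there is ONE constant `D` such that at every scale `R ≥ 1` the cut-off field
`w_R(y) = χ₁(y/R) V(y)` (`χ₁` a fixed bump, `= 1` on `B̄(0,2)`, supported in `B̄(0,3)`) is `C²`, compactly supported in `B̄(0,3R)`, equals `V` on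
`B(0,2R)`, satisfies `‖w_R‖ ≤ ‖V‖`, and has `∫ ‖w_R‖² ≤ D R^{1−2ρ}`, `∫ ‖∇w_R‖² ≤ D R^{1−ρ}`.

Proof: `‖∇χ_R‖ ≤ C₁/R` (`C₁ = sup ‖∇χ₁‖`, compact support; `exists_scaled_cutoff`); `‖w_R‖² ≤ 𝟙_{B(0,4R)}‖V‖²` and
`‖∇w_R‖² ≤ 𝟙_{B(0,4R)}(2‖DV‖² + 2(C₁/R)²‖V‖²)` (`cutoff_smul_facts`); the velocity budget at scale `4R` (`integral_sq_le_of_indicator`) and the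
E-comparison on balls `∫_{B(0,4R)}‖DV‖² ≤ (4R)^{1−ρ} E` (`SmallMoment.setLIntegral_ball_le_of_weightedEnergy` for `ρ < 1`; trivial at `ρ = 1`;
`integral_fderiv_sq_le_of_indicator`), with `4^{1−2ρ} ≤ 4⁵`, `4^{1−ρ} ≤ 4³` and `R^{−1−2ρ} ≤ R^{1−ρ}` (`ρ ≥ −2`); `D = 1024·A⁺(1 + 2C₁²) + 128·E`.

* ★ `localise (ρ : ℝ) : <NsregP2.R58c.Localise ρ unfolded>`; by-name check `example (ρ) : NsregP2.R58c.Localise ρ := PressureSeam.localise ρ`.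

HONEST FRAMING: a portrait instrument piece about HYPOTHETICAL profiles (bookkeeping for the pressure budget at scale); nothing here bears on the
crux E (19832 OPEN) or on NS regularity; not E. [nsreg-p2 R58 S58c-3; folklore]
-/

noncomputable section

set_option linter.dupNamespace false

open MeasureTheory Set Filter Topology Metric Function
open scoped NNReal ENNReal Topology

namespace Summit.NavierStokesRegularity.NavierStokesRegularity.Theorems.PowerGaugeEulerLiouville.PressureSeam

open Summit.NavierStokesRegularity.NavierStokesRegularity.Theorems.PowerGaugeEulerLiouville

/-- The E-comparison on balls for `ρ ≤ 1`: `∫⁻_{B(0,R)} ‖DV‖² ≤ R^{1−ρ} · ∫⁻ ‖DV‖² ‖y‖^{ρ−1}` (`SmallMoment.setLIntegral_ball_le_of_weightedEnergy`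
for `ρ < 1`; at `ρ = 1` the weight is `1`). [folklore] -/
theorem setLIntegral_ball_fderiv_le_of_le_one {ρ : ℝ} (hρ1 : ρ ≤ 1)
    (V : EuclideanSpace ℝ (Fin 3) → EuclideanSpace ℝ (Fin 3)) {R : ℝ} (hR : 0 < R) :
    ∫⁻ y in ball (0 : EuclideanSpace ℝ (Fin 3)) R, ‖fderiv ℝ V y‖ₑ ^ 2 ≤
      ENNReal.ofReal (R ^ (1 - ρ)) * ∫⁻ y, ‖fderiv ℝ V y‖ₑ ^ 2 * ENNReal.ofReal (‖y‖ ^ (ρ - 1)) := by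
  rcases hρ1.lt_or_eq with h | h
  · exact SmallMoment.setLIntegral_ball_le_of_weightedEnergy h V hR
  · subst h
    simp only [sub_self, Real.rpow_zero, ENNReal.ofReal_one, mul_one, one_mul]
    exact setLIntegral_le_lintegral _ _

/-- **The scaled cut-offs**: ONE constant `C₁ ≥ 0` and, for every `R > 0`, a `C²` function `χ_R` with `0 ≤ χ_R ≤ 1`, `χ_R = 1` on `B(0,2R)`,
`χ_R = 0` off `B̄(0,3R)`, `‖∇χ_R‖ ≤ C₁/R` (`χ_R(y) = χ₁(y/R)` for a fixed `ContDiffBump` `χ₁` with radii `2 < 3`). [folklore] -/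
theorem exists_scaled_cutoff :
    ∃ C₁ : ℝ, 0 ≤ C₁ ∧ ∀ R : ℝ, 0 < R → ∃ χ : EuclideanSpace ℝ (Fin 3) → ℝ,
      ContDiff ℝ 2 χ ∧ (∀ y, 0 ≤ χ y ∧ χ y ≤ 1) ∧ (∀ y ∈ ball (0 : EuclideanSpace ℝ (Fin 3)) (2 * R), χ y = 1) ∧
      (∀ y : EuclideanSpace ℝ (Fin 3), 3 * R < ‖y‖ → χ y = 0) ∧ (∀ y, ‖fderiv ℝ χ y‖ ≤ C₁ / R) := by
  set χ₁ : ContDiffBump (0 : EuclideanSpace ℝ (Fin 3)) := ⟨2, 3, by norm_num, by norm_num⟩ with hχ₁def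
  have hχ₁c : ContDiff ℝ 2 (χ₁ : EuclideanSpace ℝ (Fin 3) → ℝ) := χ₁.contDiff
  have hDχ₁c : Continuous (fderiv ℝ (χ₁ : EuclideanSpace ℝ (Fin 3) → ℝ)) := hχ₁c.continuous_fderiv (by norm_num)
  obtain ⟨C₁, hC₁⟩ := (χ₁.hasCompactSupport.fderiv (𝕜 := ℝ)).exists_bound_of_continuous hDχ₁c
  have hC₁0 : 0 ≤ C₁ := (norm_nonneg _).trans (hC₁ 0)
  refine ⟨C₁, hC₁0, fun R hR0 => ⟨fun y => χ₁ (R⁻¹ • y), hχ₁c.comp (contDiff_id.const_smul R⁻¹),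
    fun y => ⟨χ₁.nonneg, χ₁.le_one⟩, fun y hy => ?_, fun y hy => ?_, fun y => ?_⟩⟩
  · apply χ₁.one_of_mem_closedBall
    rw [mem_closedBall, dist_zero_right, norm_smul, norm_inv, Real.norm_eq_abs, abs_of_pos hR0]
    have : ‖y‖ < 2 * R := mem_ball_zero_iff.1 hy
    rw [show χ₁.rIn = 2 from rfl, inv_mul_le_iff₀ hR0]; linarith
  · apply χ₁.zero_of_le_dist
    rw [dist_zero_right, norm_smul, norm_inv, Real.norm_eq_abs, abs_of_pos hR0, show χ₁.rOut = 3 from rfl,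
      le_inv_mul_iff₀ hR0]
    linarith
  · have h1 : HasFDerivAt (fun y : EuclideanSpace ℝ (Fin 3) => R⁻¹ • y)
        (R⁻¹ • ContinuousLinearMap.id ℝ (EuclideanSpace ℝ (Fin 3))) y := (hasFDerivAt_id y).const_smul R⁻¹
    have h2 : HasFDerivAt (χ₁ : EuclideanSpace ℝ (Fin 3) → ℝ) (fderiv ℝ (χ₁ : EuclideanSpace ℝ (Fin 3) → ℝ) (R⁻¹ • y))
        (R⁻¹ • y) := ((hχ₁c.differentiable (by norm_num)) _).hasFDerivAt
    have h3 : HasFDerivAt (fun y : EuclideanSpace ℝ (Fin 3) => χ₁ (R⁻¹ • y))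
        ((fderiv ℝ (χ₁ : EuclideanSpace ℝ (Fin 3) → ℝ) (R⁻¹ • y)).comp
          (R⁻¹ • ContinuousLinearMap.id ℝ (EuclideanSpace ℝ (Fin 3)))) y := h2.comp y h1
    rw [h3.fderiv]
    calc ‖(fderiv ℝ (χ₁ : EuclideanSpace ℝ (Fin 3) → ℝ) (R⁻¹ • y)).comp (R⁻¹ • ContinuousLinearMap.id ℝ (EuclideanSpace ℝ (Fin 3)))‖
        ≤ ‖fderiv ℝ (χ₁ : EuclideanSpace ℝ (Fin 3) → ℝ) (R⁻¹ • y)‖ * ‖R⁻¹ • ContinuousLinearMap.id ℝ (EuclideanSpace ℝ (Fin 3))‖ :=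
          ContinuousLinearMap.opNorm_comp_le _ _
      _ ≤ C₁ * R⁻¹ := by
          refine mul_le_mul (hC₁ _) ?_ (norm_nonneg _) hC₁0
          rw [norm_smul, norm_inv, Real.norm_eq_abs, abs_of_pos hR0]
          exact mul_le_of_le_one_right (by positivity) ContinuousLinearMap.norm_id_le
      _ = C₁ / R := by rw [div_eq_mul_inv]

/-- **The localised field `w = χ V`**: `C²`, compactly supported in `B̄(0,3R)`, `= V` on `B(0,2R)`, `‖w‖ ≤ ‖V‖`, and the pointwise indicator bounds
`‖w‖² ≤ 𝟙_{B(0,4R)}‖V‖²`, `‖∇w‖² ≤ 𝟙_{B(0,4R)}(2‖DV‖² + 2(C₁/R)²‖V‖²)` (product rule; `w` vanishes near every point off `B̄(0,3R)`). [folklore] -/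
theorem cutoff_smul_facts {V : EuclideanSpace ℝ (Fin 3) → EuclideanSpace ℝ (Fin 3)} (hV : ContDiff ℝ 2 V) {R C₁ : ℝ} (hR0 : 0 < R)
    {χ : EuclideanSpace ℝ (Fin 3) → ℝ} (hχc : ContDiff ℝ 2 χ) (hχ01 : ∀ y, 0 ≤ χ y ∧ χ y ≤ 1)
    (hχ_one : ∀ y ∈ ball (0 : EuclideanSpace ℝ (Fin 3)) (2 * R), χ y = 1)
    (hχ_zero : ∀ y : EuclideanSpace ℝ (Fin 3), 3 * R < ‖y‖ → χ y = 0) (hDχ : ∀ y, ‖fderiv ℝ χ y‖ ≤ C₁ / R) :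
    ContDiff ℝ 2 (fun y => χ y • V y) ∧ HasCompactSupport (fun y => χ y • V y) ∧
      (∀ y ∈ ball (0 : EuclideanSpace ℝ (Fin 3)) (2 * R), χ y • V y = V y) ∧
      tsupport (fun y => χ y • V y) ⊆ closedBall (0 : EuclideanSpace ℝ (Fin 3)) (3 * R) ∧ (∀ y, ‖χ y • V y‖ ≤ ‖V y‖) ∧
      (∀ y, ‖χ y • V y‖ ^ 2 ≤ (ball (0 : EuclideanSpace ℝ (Fin 3)) (4 * R)).indicator (fun y => ‖V y‖ ^ 2) y) ∧
      (∀ y, ‖fderiv ℝ (fun y => χ y • V y) y‖ ^ 2 ≤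
        (ball (0 : EuclideanSpace ℝ (Fin 3)) (4 * R)).indicator
          (fun y => 2 * ‖fderiv ℝ V y‖ ^ 2 + 2 * ((C₁ / R) ^ 2 * ‖V y‖ ^ 2)) y) := by
  have hwc : ContDiff ℝ 2 (fun y => χ y • V y) := hχc.smul hV
  have hw_zero : ∀ y : EuclideanSpace ℝ (Fin 3), 3 * R < ‖y‖ → χ y • V y = 0 := fun y hy => by
    rw [hχ_zero y hy, zero_smul]
  have hw_supp : HasCompactSupport (fun y => χ y • V y) := by
    refine HasCompactSupport.intro (isCompact_closedBall (0 : EuclideanSpace ℝ (Fin 3)) (3 * R)) fun y hy => hw_zero y ?_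
    rw [mem_closedBall, dist_zero_right, not_le] at hy; exact hy
  have hw_norm : ∀ y, ‖χ y • V y‖ ≤ ‖V y‖ := fun y => by
    rw [norm_smul, Real.norm_eq_abs, abs_of_nonneg (hχ01 y).1]
    exact mul_le_of_le_one_left (norm_nonneg _) (hχ01 y).2
  have hDw : ∀ y, ‖fderiv ℝ (fun y => χ y • V y) y‖ ≤ ‖fderiv ℝ V y‖ + C₁ / R * ‖V y‖ := by
    intro y
    have hχd : HasFDerivAt χ (fderiv ℝ χ y) y := ((hχc.differentiable (by norm_num)) y).hasFDerivAt
    have hVd : HasFDerivAt V (fderiv ℝ V y) y := ((hV.differentiable (by norm_num)) y).hasFDerivAt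
    have h3 : HasFDerivAt (fun y => χ y • V y) (χ y • fderiv ℝ V y + (fderiv ℝ χ y).smulRight (V y)) y := hχd.smul hVd
    rw [h3.fderiv]
    calc ‖χ y • fderiv ℝ V y + (fderiv ℝ χ y).smulRight (V y)‖
        ≤ ‖χ y • fderiv ℝ V y‖ + ‖(fderiv ℝ χ y).smulRight (V y)‖ := norm_add_le _ _
      _ ≤ ‖fderiv ℝ V y‖ + C₁ / R * ‖V y‖ := by
          refine add_le_add ?_ ?_
          · rw [norm_smul, Real.norm_eq_abs, abs_of_nonneg (hχ01 y).1]
            exact mul_le_of_le_one_left (norm_nonneg _) (hχ01 y).2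
          · rw [ContinuousLinearMap.norm_smulRight_apply]
            exact mul_le_mul_of_nonneg_right (hDχ y) (norm_nonneg _)
  have hDw_zero : ∀ y : EuclideanSpace ℝ (Fin 3), 3 * R < ‖y‖ → fderiv ℝ (fun y => χ y • V y) y = 0 := by
    intro y hy
    have hopen : IsOpen {z : EuclideanSpace ℝ (Fin 3) | 3 * R < ‖z‖} := isOpen_lt continuous_const continuous_norm
    have hev : (fun y => χ y • V y) =ᶠ[𝓝 y] fun _ => 0 := by
      filter_upwards [hopen.mem_nhds hy] with z hz
      exact hw_zero z hz
    rw [hev.fderiv_eq, fderiv_const_apply]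
  refine ⟨hwc, hw_supp, fun y hy => by rw [hχ_one y hy, one_smul], ?_, hw_norm, fun y => ?_, fun y => ?_⟩
  · refine closure_minimal (fun y hy => ?_) isClosed_closedBall
    rw [mem_closedBall, dist_zero_right]
    by_contra h
    exact hy (hw_zero y (not_le.1 h))
  · by_cases hy : y ∈ ball (0 : EuclideanSpace ℝ (Fin 3)) (4 * R)
    · rw [indicator_of_mem hy]
      exact pow_le_pow_left₀ (norm_nonneg _) (hw_norm y) 2
    · rw [indicator_of_notMem hy]
      have : 3 * R < ‖y‖ := by rw [mem_ball_zero_iff, not_lt] at hy; linarith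
      rw [hw_zero y this, norm_zero]; norm_num
  · by_cases hy : y ∈ ball (0 : EuclideanSpace ℝ (Fin 3)) (4 * R)
    · rw [indicator_of_mem hy]
      have h := hDw y
      have h0 : 0 ≤ ‖fderiv ℝ (fun y => χ y • V y) y‖ := norm_nonneg _
      nlinarith [sq_nonneg (‖fderiv ℝ V y‖ - C₁ / R * ‖V y‖), h, h0]
    · rw [indicator_of_notMem hy]
      have : 3 * R < ‖y‖ := by rw [mem_ball_zero_iff, not_lt] at hy; linarith
      rw [hDw_zero y this, norm_zero]; norm_num

/-- `∫ ‖w‖² ≤ 1024·A⁺·R^{1−2ρ}` from the pointwise bound `‖w‖² ≤ 𝟙_{B(0,4R)}‖V‖²` and the velocity budget at scale `4R`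
(`4^{1−2ρ} ≤ 4⁵` for `ρ ≥ −2`). [folklore] -/
theorem integral_sq_le_of_indicator {V w : EuclideanSpace ℝ (Fin 3) → EuclideanSpace ℝ (Fin 3)} (hVc : Continuous V)
    (hwc : Continuous w) {ρ A R : ℝ} (hρ2 : -2 ≤ ρ) (hR : 1 ≤ R)
    (hA : ∀ R : ℝ, 1 ≤ R → ∫ y in ball (0 : EuclideanSpace ℝ (Fin 3)) R, ‖V y‖ ^ 2 ≤ A * R ^ (1 - 2 * ρ))
    (hsq : ∀ y, ‖w y‖ ^ 2 ≤ (ball (0 : EuclideanSpace ℝ (Fin 3)) (4 * R)).indicator (fun y => ‖V y‖ ^ 2) y) :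
    ∫ y, ‖w y‖ ^ 2 ≤ 1024 * max A 0 * R ^ (1 - 2 * ρ) := by
  have hR0 : 0 < R := by linarith
  have hVint : IntegrableOn (fun y => ‖V y‖ ^ 2) (ball (0 : EuclideanSpace ℝ (Fin 3)) (4 * R)) :=
    ((hVc.norm.pow 2).continuousOn.integrableOn_compact (isCompact_closedBall _ _)).mono_set ball_subset_closedBall
  have hVind : Integrable (fun y => (ball (0 : EuclideanSpace ℝ (Fin 3)) (4 * R)).indicator (fun y => ‖V y‖ ^ 2) y) :=
    (integrable_indicator_iff measurableSet_ball).2 hVint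
  have hwint : Integrable (fun y => ‖w y‖ ^ 2) :=
    hVind.mono' (hwc.norm.pow 2).aestronglyMeasurable
      (ae_of_all _ fun y => by rw [Real.norm_eq_abs, abs_of_nonneg (sq_nonneg _)]; exact hsq y)
  have h1 : (4 * R) ^ (1 - 2 * ρ) = (4 : ℝ) ^ (1 - 2 * ρ) * R ^ (1 - 2 * ρ) := Real.mul_rpow (by norm_num) hR0.le
  have h2 : (4 : ℝ) ^ (1 - 2 * ρ) ≤ 1024 := by
    calc (4 : ℝ) ^ (1 - 2 * ρ) ≤ (4 : ℝ) ^ (5 : ℝ) := Real.rpow_le_rpow_of_exponent_le (by norm_num) (by linarith)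
      _ = 1024 := by norm_num
  have h3 : 0 ≤ R ^ (1 - 2 * ρ) := Real.rpow_nonneg hR0.le _
  calc ∫ y, ‖w y‖ ^ 2 ≤ ∫ y, (ball (0 : EuclideanSpace ℝ (Fin 3)) (4 * R)).indicator (fun y => ‖V y‖ ^ 2) y :=
        integral_mono hwint hVind hsq
    _ = ∫ y in ball (0 : EuclideanSpace ℝ (Fin 3)) (4 * R), ‖V y‖ ^ 2 := integral_indicator measurableSet_ball
    _ ≤ A * (4 * R) ^ (1 - 2 * ρ) := hA (4 * R) (by linarith)
    _ ≤ max A 0 * ((4 : ℝ) ^ (1 - 2 * ρ) * R ^ (1 - 2 * ρ)) := by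
        rw [h1]; exact mul_le_mul_of_nonneg_right (le_max_left _ _) (by positivity)
    _ ≤ max A 0 * (1024 * R ^ (1 - 2 * ρ)) := mul_le_mul_of_nonneg_left (mul_le_mul_of_nonneg_right h2 h3) (le_max_right _ _)
    _ = 1024 * max A 0 * R ^ (1 - 2 * ρ) := by ring

/-- `∫ ‖∇w‖² ≤ (128·E + 2048·A⁺C₁²)·R^{1−ρ}` from the pointwise bound `‖∇w‖² ≤ 𝟙_{B(0,4R)}(2‖DV‖² + 2(C₁/R)²‖V‖²)`, the velocity budget at scale
`4R`, the E-comparison on `B(0,4R)` (`ρ ≤ 1`) and `R^{−1−2ρ} ≤ R^{1−ρ}` (`ρ ≥ −2`, `R ≥ 1`). [folklore] -/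
theorem integral_fderiv_sq_le_of_indicator {V w : EuclideanSpace ℝ (Fin 3) → EuclideanSpace ℝ (Fin 3)} (hV : ContDiff ℝ 2 V)
    (hwc : ContDiff ℝ 2 w) {ρ A R C₁ : ℝ} (hρ2 : -2 ≤ ρ) (hρ1 : ρ ≤ 1) (hR : 1 ≤ R)
    (hE : (∫⁻ y, ‖fderiv ℝ V y‖ₑ ^ 2 * ENNReal.ofReal (‖y‖ ^ (ρ - 1))) ≠ ⊤)
    (hA : ∀ R : ℝ, 1 ≤ R → ∫ y in ball (0 : EuclideanSpace ℝ (Fin 3)) R, ‖V y‖ ^ 2 ≤ A * R ^ (1 - 2 * ρ))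
    (hDsq : ∀ y, ‖fderiv ℝ w y‖ ^ 2 ≤
      (ball (0 : EuclideanSpace ℝ (Fin 3)) (4 * R)).indicator (fun y => 2 * ‖fderiv ℝ V y‖ ^ 2 + 2 * ((C₁ / R) ^ 2 * ‖V y‖ ^ 2)) y) :
    ∫ y, ‖fderiv ℝ w y‖ ^ 2 ≤
      (128 * (∫⁻ y, ‖fderiv ℝ V y‖ₑ ^ 2 * ENNReal.ofReal (‖y‖ ^ (ρ - 1))).toReal + 2048 * max A 0 * C₁ ^ 2) * R ^ (1 - ρ) := by
  have hR0 : 0 < R := by linarith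
  set Er : ℝ := (∫⁻ y, ‖fderiv ℝ V y‖ₑ ^ 2 * ENNReal.ofReal (‖y‖ ^ (ρ - 1))).toReal with hEr
  have hA'0 : 0 ≤ max A 0 := le_max_right _ _
  have hVc : Continuous V := hV.continuous
  have hDVc : Continuous (fderiv ℝ V) := hV.continuous_fderiv (by norm_num)
  have hVint : IntegrableOn (fun y => ‖V y‖ ^ 2) (ball (0 : EuclideanSpace ℝ (Fin 3)) (4 * R)) :=
    ((hVc.norm.pow 2).continuousOn.integrableOn_compact (isCompact_closedBall _ _)).mono_set ball_subset_closedBall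
  have hDVint : IntegrableOn (fun y => ‖fderiv ℝ V y‖ ^ 2) (ball (0 : EuclideanSpace ℝ (Fin 3)) (4 * R)) :=
    ((hDVc.norm.pow 2).continuousOn.integrableOn_compact (isCompact_closedBall _ _)).mono_set ball_subset_closedBall
  -- the velocity budget at scale `4R`
  have hVbud : ∫ y in ball (0 : EuclideanSpace ℝ (Fin 3)) (4 * R), ‖V y‖ ^ 2 ≤ 1024 * max A 0 * R ^ (1 - 2 * ρ) := by
    have h1 : (4 * R) ^ (1 - 2 * ρ) = (4 : ℝ) ^ (1 - 2 * ρ) * R ^ (1 - 2 * ρ) := Real.mul_rpow (by norm_num) hR0.le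
    have h2 : (4 : ℝ) ^ (1 - 2 * ρ) ≤ 1024 := by
      calc (4 : ℝ) ^ (1 - 2 * ρ) ≤ (4 : ℝ) ^ (5 : ℝ) := Real.rpow_le_rpow_of_exponent_le (by norm_num) (by linarith)
        _ = 1024 := by norm_num
    have h3 : 0 ≤ R ^ (1 - 2 * ρ) := Real.rpow_nonneg hR0.le _
    calc ∫ y in ball (0 : EuclideanSpace ℝ (Fin 3)) (4 * R), ‖V y‖ ^ 2 ≤ A * (4 * R) ^ (1 - 2 * ρ) := hA (4 * R) (by linarith)
      _ ≤ max A 0 * ((4 : ℝ) ^ (1 - 2 * ρ) * R ^ (1 - 2 * ρ)) := by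
          rw [h1]; exact mul_le_mul_of_nonneg_right (le_max_left _ _) (by positivity)
      _ ≤ max A 0 * (1024 * R ^ (1 - 2 * ρ)) := mul_le_mul_of_nonneg_left (mul_le_mul_of_nonneg_right h2 h3) hA'0
      _ = 1024 * max A 0 * R ^ (1 - 2 * ρ) := by ring
  -- the E-budget at scale `4R`
  have hDVbud : ∫ y in ball (0 : EuclideanSpace ℝ (Fin 3)) (4 * R), ‖fderiv ℝ V y‖ ^ 2 ≤ 64 * Er * R ^ (1 - ρ) := by
    have h1 : ∫ y in ball (0 : EuclideanSpace ℝ (Fin 3)) (4 * R), ‖fderiv ℝ V y‖ ^ 2 =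
        (∫⁻ y in ball (0 : EuclideanSpace ℝ (Fin 3)) (4 * R), ‖fderiv ℝ V y‖ₑ ^ 2).toReal := by
      rw [integral_eq_lintegral_of_nonneg_ae (f := fun y => ‖fderiv ℝ V y‖ ^ 2) (ae_of_all _ fun y => sq_nonneg ‖fderiv ℝ V y‖)
        (hDVc.norm.pow 2).aestronglyMeasurable]
      congr 1
      refine lintegral_congr fun y => ?_
      rw [← ofReal_norm, ENNReal.ofReal_pow (norm_nonneg _)]
    rw [h1]
    have h2 := setLIntegral_ball_fderiv_le_of_le_one hρ1 V (by positivity : (0 : ℝ) < 4 * R)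
    have h3 : (∫⁻ y in ball (0 : EuclideanSpace ℝ (Fin 3)) (4 * R), ‖fderiv ℝ V y‖ₑ ^ 2).toReal ≤ (4 * R) ^ (1 - ρ) * Er := by
      have := ENNReal.toReal_mono (ENNReal.mul_ne_top ENNReal.ofReal_ne_top hE) h2
      rwa [ENNReal.toReal_mul, ENNReal.toReal_ofReal (by positivity)] at this
    refine h3.trans ?_
    have h4 : (4 * R) ^ (1 - ρ) = (4 : ℝ) ^ (1 - ρ) * R ^ (1 - ρ) := Real.mul_rpow (by norm_num) hR0.le
    have h5 : (4 : ℝ) ^ (1 - ρ) ≤ 64 := by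
      calc (4 : ℝ) ^ (1 - ρ) ≤ (4 : ℝ) ^ (3 : ℝ) := Real.rpow_le_rpow_of_exponent_le (by norm_num) (by linarith)
        _ = 64 := by norm_num
    rw [h4]
    have h6 : 0 ≤ R ^ (1 - ρ) := Real.rpow_nonneg hR0.le _
    have hEr0 : 0 ≤ Er := ENNReal.toReal_nonneg
    calc (4 : ℝ) ^ (1 - ρ) * R ^ (1 - ρ) * Er ≤ 64 * R ^ (1 - ρ) * Er :=
          mul_le_mul_of_nonneg_right (mul_le_mul_of_nonneg_right h5 h6) hEr0
      _ = 64 * Er * R ^ (1 - ρ) := by ring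
  have hint2 : IntegrableOn (fun y => 2 * ‖fderiv ℝ V y‖ ^ 2 + 2 * ((C₁ / R) ^ 2 * ‖V y‖ ^ 2))
      (ball (0 : EuclideanSpace ℝ (Fin 3)) (4 * R)) := (hDVint.const_mul 2).add ((hVint.const_mul _).const_mul 2)
  have hind2 : Integrable (fun y => (ball (0 : EuclideanSpace ℝ (Fin 3)) (4 * R)).indicator
      (fun y => 2 * ‖fderiv ℝ V y‖ ^ 2 + 2 * ((C₁ / R) ^ 2 * ‖V y‖ ^ 2)) y) :=
    (integrable_indicator_iff measurableSet_ball).2 hint2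
  have hDwint : Integrable (fun y => ‖fderiv ℝ w y‖ ^ 2) :=
    hind2.mono' ((hwc.continuous_fderiv (by norm_num)).norm.pow 2).aestronglyMeasurable
      (ae_of_all _ fun y => by rw [Real.norm_eq_abs, abs_of_nonneg (sq_nonneg _)]; exact hDsq y)
  have hexp : R ^ (-1 - 2 * ρ) ≤ R ^ (1 - ρ) := Real.rpow_le_rpow_of_exponent_le hR (by linarith)
  have hRm2 : R ^ (1 - 2 * ρ) / R ^ 2 = R ^ (-1 - 2 * ρ) := by
    rw [div_eq_iff (by positivity), ← Real.rpow_natCast R 2, ← Real.rpow_add hR0]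
    congr 1
    push_cast
    ring
  calc ∫ y, ‖fderiv ℝ w y‖ ^ 2
      ≤ ∫ y, (ball (0 : EuclideanSpace ℝ (Fin 3)) (4 * R)).indicator
          (fun y => 2 * ‖fderiv ℝ V y‖ ^ 2 + 2 * ((C₁ / R) ^ 2 * ‖V y‖ ^ 2)) y :=
        integral_mono hDwint hind2 hDsq
    _ = ∫ y in ball (0 : EuclideanSpace ℝ (Fin 3)) (4 * R), (2 * ‖fderiv ℝ V y‖ ^ 2 + 2 * ((C₁ / R) ^ 2 * ‖V y‖ ^ 2)) :=
        integral_indicator measurableSet_ball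
    _ = 2 * (∫ y in ball (0 : EuclideanSpace ℝ (Fin 3)) (4 * R), ‖fderiv ℝ V y‖ ^ 2) +
          2 * ((C₁ / R) ^ 2 * ∫ y in ball (0 : EuclideanSpace ℝ (Fin 3)) (4 * R), ‖V y‖ ^ 2) := by
        rw [integral_add (hDVint.const_mul 2) ((hVint.const_mul _).const_mul 2), integral_const_mul, integral_const_mul,
          integral_const_mul]
    _ ≤ 2 * (64 * Er * R ^ (1 - ρ)) + 2 * ((C₁ / R) ^ 2 * (1024 * max A 0 * R ^ (1 - 2 * ρ))) :=
        add_le_add (mul_le_mul_of_nonneg_left hDVbud (by norm_num))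
          (mul_le_mul_of_nonneg_left (mul_le_mul_of_nonneg_left hVbud (sq_nonneg _)) (by norm_num))
    _ = 128 * Er * R ^ (1 - ρ) + 2048 * max A 0 * C₁ ^ 2 * (R ^ (1 - 2 * ρ) / R ^ 2) := by
        field_simp
        ring
    _ ≤ 128 * Er * R ^ (1 - ρ) + 2048 * max A 0 * C₁ ^ 2 * R ^ (1 - ρ) := by
        rw [hRm2]
        have : 0 ≤ 2048 * max A 0 * C₁ ^ 2 := by positivity
        nlinarith [mul_le_mul_of_nonneg_left hexp this]
    _ = (128 * Er + 2048 * max A 0 * C₁ ^ 2) * R ^ (1 - ρ) := by ring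

/-- ★ **S3 `Localise ρ` PROVED** (text = `NsregP2.R58c.Localise ρ` of `r58/Sketch58c.lean` c6fe466b7b48535d with `EBudget`, `VelocityBudget`
δ-unfolded): the cut-off field at scale `R` — `w = V` on `B(0,2R)`, `tsupport w ⊆ B̄(0,3R)`, `‖w‖ ≤ ‖V‖`, `∫‖w‖² ≤ D R^{1−2ρ}`,
`∫‖∇w‖² ≤ D R^{1−ρ}` — for a `C²` field with the two budgets, `−2 ≤ ρ ≤ 1`, with ONE constant `D` for all `R ≥ 1`. [nsreg-p2 R58 S58c-3; folklore] -/
theorem localise (ρ : ℝ) :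
    ∀ V : EuclideanSpace ℝ (Fin 3) → EuclideanSpace ℝ (Fin 3), ContDiff ℝ 2 V →
      (∫⁻ y, ‖fderiv ℝ V y‖ₑ ^ 2 * ENNReal.ofReal (‖y‖ ^ (ρ - 1))) ≠ ⊤ →
      (∃ A : ℝ, ∀ R : ℝ, 1 ≤ R → ∫ y in ball (0 : EuclideanSpace ℝ (Fin 3)) R, ‖V y‖ ^ 2 ≤ A * R ^ (1 - 2 * ρ)) →
      -2 ≤ ρ → ρ ≤ 1 →
      ∃ D : ℝ, ∀ R : ℝ, 1 ≤ R → ∃ w : EuclideanSpace ℝ (Fin 3) → EuclideanSpace ℝ (Fin 3),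
        ContDiff ℝ 2 w ∧ HasCompactSupport w ∧ (∀ y ∈ ball (0 : EuclideanSpace ℝ (Fin 3)) (2 * R), w y = V y) ∧
        tsupport w ⊆ closedBall (0 : EuclideanSpace ℝ (Fin 3)) (3 * R) ∧ (∀ y, ‖w y‖ ≤ ‖V y‖) ∧
        (∫ y, ‖w y‖ ^ 2) ≤ D * R ^ (1 - 2 * ρ) ∧ (∫ y, ‖fderiv ℝ w y‖ ^ 2) ≤ D * R ^ (1 - ρ) := by
  intro V hV hE hA hρ2 hρ1
  obtain ⟨A, hA⟩ := hA
  obtain ⟨C₁, hC₁0, hcut⟩ := exists_scaled_cutoff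
  set Er : ℝ := (∫⁻ y, ‖fderiv ℝ V y‖ₑ ^ 2 * ENNReal.ofReal (‖y‖ ^ (ρ - 1))).toReal with hEr
  have hEr0 : 0 ≤ Er := ENNReal.toReal_nonneg
  have hA'0 : 0 ≤ max A 0 := le_max_right _ _
  refine ⟨1024 * max A 0 * (1 + 2 * C₁ ^ 2) + 128 * Er, fun R hR => ?_⟩
  have hR0 : 0 < R := by linarith
  obtain ⟨χ, hχc, hχ01, hχ_one, hχ_zero, hDχ⟩ := hcut R hR0
  obtain ⟨hwc, hw_supp, hw_eq, hw_tsupp, hw_norm, hsq, hDsq⟩ := cutoff_smul_facts hV hR0 hχc hχ01 hχ_one hχ_zero hDχ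
  refine ⟨fun y => χ y • V y, hwc, hw_supp, hw_eq, hw_tsupp, hw_norm, ?_, ?_⟩
  · refine (integral_sq_le_of_indicator hV.continuous hwc.continuous hρ2 hR hA hsq).trans ?_
    refine mul_le_mul_of_nonneg_right ?_ (Real.rpow_nonneg hR0.le _)
    nlinarith [mul_nonneg hA'0 (sq_nonneg C₁)]
  · refine (integral_fderiv_sq_le_of_indicator hV hwc hρ2 hρ1 hR hE hA hDsq).trans ?_
    refine mul_le_mul_of_nonneg_right ?_ (Real.rpow_nonneg hR0.le _)
    rw [← hEr]
    nlinarith [mul_nonneg hA'0 (sq_nonneg C₁)]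

end Summit.NavierStokesRegularity.NavierStokesRegularity.Theorems.PowerGaugeEulerLiouville.PressureSeam

end
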